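import Mathlib
import Summits.RiemannHypothesis.RiemannHypothesis.Theorems.DensityLadderSeparatedTowerMVLower
import Summits.RiemannHypothesis.RiemannHypothesis.Theorems.DensityLadderSeparatedTowerTransform
import HarnessLib

/-!
# `DensityLadder.SeparatedTowerDensityLine` (item stmt-RiemannHypothesis-24918) — LOWER glue of
# stub S1: the visible tower zeros are counted by the Gaussian mean square

LINE L57 «sieve sight above the density line» (rh-idea-10 g1), crux K1 `SeparatedTowerDensityLine`
(stmt-RiemannHypothesis-24918), stub S1 `stub_separatedMeanValueCount` of the registered skeleton
`Birth.lean`; division of record RULING #486 (cell rh-split): prover-l57b = LOWER glue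
(finite mean square + Montgomery–Vaughan lower bound `mv_lower_bound` of prover-l57 + visibility
`re_windowTransform_ge` of prover-l57).  Content:
* `mv_lower_count`: for a finite `g`-separated family and `U ≥ 0`, every sub-family `P` on which
  `‖b_i‖ ≥ κ ≥ 0` and `β_i ≥ σ₀` contributes
  `(1/2)√(2π)(2/g) κ² e^{2σ₀U} · #P ≤ Re Σ_{i,j} b_i conj(b_j) Ĝ_{ij}` (the Gaussian mean square);
* `norm_coeff_ge_of_visible`: with `b_i = m_i ĉ_i(η)`, `m_i ≥ 1`, `0 ≤ Re ρ_i ≤ 1`, `φ ≥ 0`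
  continuous and `η(1+|Im ρ_i|) ≤ 1/4`: `‖b_i‖ ≥ (7/16)∫φ`.
Cell rh-split, seat rh-split-prover-l57b g0.  RH-free, ζ-free; FRONTIER bookkeeping (DH-capped);
nothing here bears on the truth of RH.
-/

set_option linter.dupNamespace false

noncomputable section

open Complex Filter Set MeasureTheory Topology
open scoped Real ComplexConjugate

namespace Summit.RiemannHypothesis.RiemannHypothesis.Theorems.DensityLadderSeparatedTowerLower

open Summit.RiemannHypothesis.RiemannHypothesis.Theorems.DensityLadderSeparatedTowerMVLower
open Summit.RiemannHypothesis.RiemannHypothesis.Theorems.DensityLadderSeparatedTowerTransform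

/-- **Counting visible zeros by the mean square.**  For a finite index set `F`, rates
`ρ_j = β_j + iγ_j` with `g`-separated ordinates on `F` (`g > 0`), coefficients `b_j`, a centre
`U ≥ 0`, and a sub-family `P ⊆ F` on which `σ₀ ≤ β_i` and `κ ≤ ‖b_i‖` (`κ ≥ 0`):
`(1/2)√(2π)(2/g) · κ² e^{2σ₀U} · #P ≤ Re Σ_{i,j∈F} b_i conj(b_j) √(2π)(2/g) e^{z_{ij}U + z_{ij}²(2/g)²/2}`,
`z_{ij} = (β_i+β_j) + i(γ_i−γ_j)` (Montgomery–Vaughan lower bound, then drop the invisible terms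
and use `e^{2β_iU + 2β_i²L²} ≥ e^{2σ₀U}`). [folklore] -/
theorem mv_lower_count {ι : Type} [DecidableEq ι] (F : Finset ι) (β γ : ι → ℝ) (b : ι → ℂ)
    {g : ℝ} (hg : 0 < g) (hsep : ∀ i ∈ F, ∀ j ∈ F, i ≠ j → g ≤ |γ i - γ j|) {U : ℝ} (hU : 0 ≤ U)
    (P : Finset ι) (hPF : P ⊆ F) {σ₀ κ : ℝ} (hκ : 0 ≤ κ) (hPβ : ∀ i ∈ P, σ₀ ≤ β i)
    (hPb : ∀ i ∈ P, κ ≤ ‖b i‖) :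
    (1 / 2) * (Real.sqrt (2 * π) * (2 / g)) * (κ ^ 2 * Real.exp (2 * σ₀ * U) * P.card) ≤
      (∑ i ∈ F, ∑ j ∈ F, b i * conj (b j) * (((Real.sqrt (2 * π) * (2 / g) : ℝ) : ℂ) *
        cexp ((((β i + β j : ℝ) : ℂ) + (γ i - γ j : ℝ) * I) * U +
          (((β i + β j : ℝ) : ℂ) + (γ i - γ j : ℝ) * I) ^ 2 * (2 / g : ℝ) ^ 2 / 2))).re := by
  have hmv := mv_lower_bound F β γ b hg hsep U
  refine le_trans ?_ hmv
  have hc : 0 ≤ (1 / 2) * (Real.sqrt (2 * π) * (2 / g)) := by positivity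
  refine mul_le_mul_of_nonneg_left ?_ hc
  -- termwise on `P`, and the terms off `P` are nonnegative
  have hterm : ∀ i ∈ P, κ ^ 2 * Real.exp (2 * σ₀ * U) ≤
      ‖b i‖ ^ 2 * Real.exp (2 * β i * U + 2 * β i ^ 2 * (2 / g) ^ 2) := by
    intro i hi
    have h1 : κ ^ 2 ≤ ‖b i‖ ^ 2 := pow_le_pow_left₀ hκ (hPb i hi) 2
    have h2 : Real.exp (2 * σ₀ * U) ≤ Real.exp (2 * β i * U + 2 * β i ^ 2 * (2 / g) ^ 2) := by
      rw [Real.exp_le_exp]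
      have := hPβ i hi
      nlinarith [sq_nonneg (β i * (2 / g))]
    exact mul_le_mul h1 h2 (Real.exp_pos _).le (sq_nonneg _)
  calc κ ^ 2 * Real.exp (2 * σ₀ * U) * P.card
      = ∑ i ∈ P, κ ^ 2 * Real.exp (2 * σ₀ * U) := by rw [Finset.sum_const, nsmul_eq_mul]; ring
    _ ≤ ∑ i ∈ P, ‖b i‖ ^ 2 * Real.exp (2 * β i * U + 2 * β i ^ 2 * (2 / g) ^ 2) :=
        Finset.sum_le_sum hterm
    _ ≤ ∑ i ∈ F, ‖b i‖ ^ 2 * Real.exp (2 * β i * U + 2 * β i ^ 2 * (2 / g) ^ 2) :=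
        Finset.sum_le_sum_of_subset_of_nonneg hPF fun i _ _ ↦ by positivity

/-- **Visibility of a tower zero at height `T = 1/η`.**  With `b = m · ĉ_ρ(η)`,
`ĉ_ρ(η) = ∫_{-1}^{1} φ(v)(1+ηv)^{ρ−1} dv`, `m ≥ 1`, `φ ≥ 0` continuous, `0 < η ≤ 1/2`,
`0 ≤ Re ρ ≤ 1` and `η(1+|Im ρ|) ≤ 1/4`: `‖b‖ ≥ (7/16) ∫_{-1}^{1} φ`. [folklore] -/
theorem norm_coeff_ge_of_visible (φ : ℝ → ℝ) (hφc : Continuous φ) (hφ0 : ∀ v, 0 ≤ φ v)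
    {η : ℝ} (hη : 0 < η) (hη1 : η ≤ 1 / 2) {ρ : ℂ} (h0 : 0 ≤ ρ.re) (h1 : ρ.re ≤ 1)
    (hγ : η * (1 + |ρ.im|) ≤ 1 / 4) {m : ℝ} (hm : 1 ≤ m) :
    7 / 16 * (∫ v in (-1 : ℝ)..1, φ v) ≤
      ‖(m : ℂ) * ∫ v in (-1 : ℝ)..1, (φ v : ℂ) * ((1 : ℂ) + (η : ℂ) * (v : ℂ)) ^ (ρ - 1)‖ := by
  have hvis := re_windowTransform_ge φ hφc hφ0 hη hη1 h0 h1 hγ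
  have hI0 : 0 ≤ ∫ v in (-1 : ℝ)..1, φ v :=
    intervalIntegral.integral_nonneg (by norm_num) fun v _ ↦ hφ0 v
  rw [norm_mul, Complex.norm_real, Real.norm_of_nonneg (by linarith)]
  calc 7 / 16 * (∫ v in (-1 : ℝ)..1, φ v) = 1 * (7 / 16 * ∫ v in (-1 : ℝ)..1, φ v) := by ring
    _ ≤ m * ‖∫ v in (-1 : ℝ)..1, (φ v : ℂ) * ((1 : ℂ) + (η : ℂ) * (v : ℂ)) ^ (ρ - 1)‖ :=
        mul_le_mul hm (hvis.trans (Complex.re_le_norm _)) (by positivity) (by linarith)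

/-- The rate pairing of the Gaussian mean square: `ρ_i + conj ρ_j = (β_i+β_j) + i(γ_i−γ_j)` with
`β = Re ρ`, `γ = Im ρ` (bridges `integral_normSq_sum_mul_gaussian` of file `…Gaussian`, written with
`ρ_i + conj ρ_j`, to `mv_lower_bound` of file `…MVLower`, written with `β, γ`). [folklore] -/
theorem add_conj_eq_re_im (z w : ℂ) :
    z + conj w = (((z.re + w.re : ℝ) : ℂ) + ((z.im - w.im : ℝ) : ℂ) * I) := by
  apply Complex.ext
  · simp
  · simp; ring

/-- **LOWER sub-goal of stub S1 (prover-l57b's half, RULING #486/#488 of cell rh-split).**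
In the vocabulary of K1: let `φ ≥ 0` be continuous, `0 < η ≤ 1/2`, `g > 0`, `U ≥ 0`, and let `F` be a
finite set of indices whose ordinates `Im ρ_i` are pairwise `g`-separated.  Suppose every index `i`
with `σ₀ ≤ Re ρ_i` and `|Im ρ_i| ≤ R` lies in `F` and has `Re ρ_i ≤ 1`, `m_i ≥ 1` (the tower zeros of
real part `≥ σ₀` up to height `R`), where the height is VISIBLE: `η(1+R) ≤ 1/4`, and `σ₀ ≥ 0`.
Then, with `b_i = m_i ĉ_i(η)`, `ĉ_i(η) = ∫_{-1}^{1} φ(v)(1+ηv)^{ρ_i−1} dv`, `L = 2/g` and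
`z_{ij} = (Re ρ_i + Re ρ_j) + i(Im ρ_i − Im ρ_j)`,
`(1/2)√(2π)L · (7∫φ/16)² · e^{2σ₀U} · #{i | σ₀ ≤ Re ρ_i ∧ |Im ρ_i| ≤ R}`
`  ≤ Re Σ_{i,j∈F} b_i conj(b_j) √(2π)L e^{z_{ij}U + z_{ij}²L²/2}`
— the real part of the Gaussian mean square `∫ |Σ_{i∈F} b_i e^{ρ_i u}|² e^{−(u−U)²/(2L²)} du`
(file `…Gaussian`, `integral_normSq_sum_mul_gaussian`, via `add_conj_eq_re_im`).  In the assembly: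
`η = 1/T`, `U = log T` (so `e^{2σ₀U} = T^{2σ₀}`), `R = T/4 − 1`, `F ⊇ {σ₀ ≤ Re ρ ∧ |Im ρ| ≤ T²}`.
[folklore] -/
theorem separatedTower_lower {ι : Type} [DecidableEq ι] (m : ι → ℝ) (ρ : ι → ℂ) (φ : ℝ → ℝ)
    (hφc : Continuous φ) (hφ0 : ∀ v, 0 ≤ φ v) {η : ℝ} (hη : 0 < η) (hη1 : η ≤ 1 / 2)
    {g : ℝ} (hg : 0 < g) {σ₀ R U : ℝ} (hσ₀ : 0 ≤ σ₀) (hU : 0 ≤ U) (hR : η * (1 + R) ≤ 1 / 4)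
    (F : Finset ι) (hsep : ∀ i ∈ F, ∀ j ∈ F, i ≠ j → g ≤ |(ρ i).im - (ρ j).im|)
    (hPF : ∀ i, σ₀ ≤ (ρ i).re → |(ρ i).im| ≤ R → i ∈ F)
    (hP : ∀ i, σ₀ ≤ (ρ i).re → |(ρ i).im| ≤ R → (ρ i).re ≤ 1 ∧ 1 ≤ m i) :
    (1 / 2) * (Real.sqrt (2 * π) * (2 / g)) *
        ((7 / 16 * ∫ v in (-1 : ℝ)..1, φ v) ^ 2 * Real.exp (2 * σ₀ * U) *
          ({i : ι | σ₀ ≤ (ρ i).re ∧ |(ρ i).im| ≤ R}.ncard : ℝ)) ≤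
      (∑ i ∈ F, ∑ j ∈ F,
        ((m i : ℂ) * ∫ v in (-1 : ℝ)..1, (φ v : ℂ) * ((1 : ℂ) + (η : ℂ) * (v : ℂ)) ^ (ρ i - 1)) *
        conj ((m j : ℂ) * ∫ v in (-1 : ℝ)..1, (φ v : ℂ) * ((1 : ℂ) + (η : ℂ) * (v : ℂ)) ^ (ρ j - 1)) *
        (((Real.sqrt (2 * π) * (2 / g) : ℝ) : ℂ) *
          cexp (((((ρ i).re + (ρ j).re : ℝ) : ℂ) + ((ρ i).im - (ρ j).im : ℝ) * I) * U +
            ((((ρ i).re + (ρ j).re : ℝ) : ℂ) + ((ρ i).im - (ρ j).im : ℝ) * I) ^ 2 *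
              (2 / g : ℝ) ^ 2 / 2))).re := by
  classical
  set b : ι → ℂ := fun i ↦ (m i : ℂ) *
    ∫ v in (-1 : ℝ)..1, (φ v : ℂ) * ((1 : ℂ) + (η : ℂ) * (v : ℂ)) ^ (ρ i - 1) with hb
  set P : Finset ι := F.filter (fun i ↦ σ₀ ≤ (ρ i).re ∧ |(ρ i).im| ≤ R) with hPdef
  have hPF' : P ⊆ F := Finset.filter_subset _ _
  have hPset : {i : ι | σ₀ ≤ (ρ i).re ∧ |(ρ i).im| ≤ R} = ↑P := by
    ext i
    simp only [Set.mem_setOf_eq, hPdef, Finset.coe_filter]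
    constructor
    · intro h; exact ⟨hPF i h.1 h.2, h⟩
    · intro h; exact h.2
  have hcard : ({i : ι | σ₀ ≤ (ρ i).re ∧ |(ρ i).im| ≤ R}.ncard : ℝ) = P.card := by
    rw [hPset, Set.ncard_coe_finset]
  rw [hcard]
  have hκ : 0 ≤ 7 / 16 * ∫ v in (-1 : ℝ)..1, φ v := by
    have : 0 ≤ ∫ v in (-1 : ℝ)..1, φ v :=
      intervalIntegral.integral_nonneg (by norm_num) fun v _ ↦ hφ0 v
    positivity
  have hPβ : ∀ i ∈ P, σ₀ ≤ (fun i ↦ (ρ i).re) i := by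
    intro i hi; rw [hPdef, Finset.mem_filter] at hi; exact hi.2.1
  have hPb : ∀ i ∈ P, 7 / 16 * (∫ v in (-1 : ℝ)..1, φ v) ≤ ‖b i‖ := by
    intro i hi
    rw [hPdef, Finset.mem_filter] at hi
    obtain ⟨_, hσ, hγ⟩ := hi
    obtain ⟨h1, hm⟩ := hP i hσ hγ
    have h0 : 0 ≤ (ρ i).re := hσ₀.trans hσ
    have hvis : η * (1 + |(ρ i).im|) ≤ 1 / 4 :=
      le_trans (mul_le_mul_of_nonneg_left (by linarith) hη.le) hR
    exact norm_coeff_ge_of_visible φ hφc hφ0 hη hη1 h0 h1 hvis hm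
  have key := mv_lower_count F (fun i ↦ (ρ i).re) (fun i ↦ (ρ i).im) b hg hsep hU P hPF' hκ hPβ hPb
  exact key

end Summit.RiemannHypothesis.RiemannHypothesis.Theorems.DensityLadderSeparatedTowerLower

end
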